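import Summits.NavierStokesRegularity.NavierStokesRegularity.Theorems.ScalingDefectPeepholeDoorSerrinSmoothSlices
import Literature.Analysis.FluidPDE.ClassicalSuitableRegion
import Literature.Analysis.FluidPDE.NSBootstrapContinuousRep
import HarnessLib

/-!
# ScalingDefectPeepholeDoorSerrinClassical — door S30 «ScalingDefectPeepholeDoor», effective plate E0 (step E3c):
# pressure-free interior derivative bounds for bounded CLASSICAL Navier–Stokes solutions

Eighth file of the pressure-free Serrin chain, its user-facing end: **for every order `k`, every
`0 < r' < R` and every `M` there is `K = K(k, R, r', M)` such that every classical Navier–Stokes solution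
`(u, p)` (`ν = 1`, `f = 0`) on the centred cylinder `Q*_R(-R², 0) = ]-2R², 0[ × B(0, R)` with `|u| ≤ M`
there satisfies `‖D_xᵏ u(t, ·)(x)‖ ≤ K` on `]-r'², 0[ × B(0, r')`** — Serrin's interior estimate (Serrin 1962;
Chen–Strain–Tsai–Yau 2009, Lemma A.2; Pineau–Vicol 2026, Lemma 9.1) with NO hypothesis on the pressure.
A classical solution is a bounded distributional solution with the slice derivative as weak gradient
(`IsClassicalNSSolutionOnRegion.isDistributionalNSSolutionOn / hasWeakSpatialGradientOn`), so
`Serrin.aeSmoothSlices` (step E3b) bounds the derivatives of smooth a.e.-representatives of the slices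
`u_b(t, ·)` for a.e. `t`; continuity identifies the representatives with the slices and extends the bound
to every `t`.

Door S30 is a regularity CRITERION inside a HYPOTHETICAL local Type-I blow-up; item 0056 `NoTypeII`
stays OPEN; nothing here bears on NS regularity itself.
-/

noncomputable section

set_option linter.dupNamespace false

namespace Summit.NavierStokesRegularity.NavierStokesRegularity.Theorems.ScalingDefectPeepholeDoor

namespace Serrin

open MeasureTheory Set Function Filter Topology TopologicalSpace Metric InnerProductSpace
open scoped NNReal ENNReal RealInnerProductSpace Laplacian ContDiff
open Literature.Analysis Literature.Analysis.FluidPDE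
open NSBootstrap
open scoped Pointwise

/-! ### Slices of a jointly smooth field (twin of the private lemmas of `LocalEnstrophyBalance`) -/

/-- Iterated partial derivatives in the second variable are restrictions of iterated total
derivatives: for `f` of class `C^∞` on an open `s ⊆ E × F` and `(x, w) ∈ s`, the `j`-th derivative
of `w' ↦ f (x, w')` at `w` is the `j`-th derivative of `f` at `(x, w)` composed with the inclusions
`inr : F → E × F` in every slot. [folklore] -/
theorem iteratedFDeriv_slice_eq_comp_inr {E F G : Type*}
    [NormedAddCommGroup E] [NormedSpace ℝ E] [NormedAddCommGroup F] [NormedSpace ℝ F]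
    [NormedAddCommGroup G] [NormedSpace ℝ G] {f : E × F → G} {s : Set (E × F)}
    (hs : IsOpen s) (hf : ContDiffOn ℝ ∞ f s) {x : E} {w : F} (hx : (x, w) ∈ s) (j : ℕ) :
    iteratedFDeriv ℝ j (fun w' ↦ f (x, w')) w =
      (iteratedFDeriv ℝ j f (x, w)).compContinuousLinearMap
        fun _ ↦ ContinuousLinearMap.inr ℝ E F := by
  set a : E × F := (x, 0) with ha
  set s' : Set (E × F) := (fun z ↦ z + a) ⁻¹' s with hs'
  set g : E × F → G := fun z ↦ f (z + a) with hg
  have hs'o : IsOpen s' := hs.preimage (continuous_id.add continuous_const)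
  have hvadd : a +ᵥ s' = s := by
    ext z
    rw [Set.mem_vadd_set]
    constructor
    · rintro ⟨y, hy, rfl⟩
      have : y + a ∈ s := hy
      rwa [vadd_eq_add, add_comm]
    · intro hz
      refine ⟨z - a, ?_, by rw [vadd_eq_add]; abel⟩
      show z - a + a ∈ s
      rwa [sub_add_cancel]
  have hgs : ContDiffOn ℝ ∞ g s' := hf.comp (contDiffOn_id.add contDiffOn_const) fun z hz ↦ hz
  have hfun : (fun w' ↦ f (x, w')) = g ∘ ContinuousLinearMap.inr ℝ E F := by
    funext w'; simp [hg, ha]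
  have hxs' : ContinuousLinearMap.inr ℝ E F w ∈ s' := by
    show ((0 : E), w) + a ∈ s; simpa [ha] using hx
  have hpre : IsOpen (ContinuousLinearMap.inr ℝ E F ⁻¹' s') :=
    hs'o.preimage (ContinuousLinearMap.inr ℝ E F).continuous
  rw [hfun, ← iteratedFDerivWithin_of_isOpen j hpre hxs',
    (ContinuousLinearMap.inr ℝ E F).iteratedFDerivWithin_comp_right hgs hs'o.uniqueDiffOn
      hpre.uniqueDiffOn hxs' (by exact_mod_cast le_top)]
  congr 1
  rw [hg, iteratedFDerivWithin_comp_add_right j a, hvadd, iteratedFDerivWithin_of_isOpen j hs]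
  · congr 1; simp [ha]
  · simpa [ha] using hx

/-- The spatial Taylor coefficients `(t, x) ↦ D_xⁿ w(t, ·)(x)` of a field jointly `C^∞` on a
product `I × S` of open sets are jointly continuous there. [folklore] -/
theorem continuousOn_iteratedFDeriv_slice {G : Type*} [NormedAddCommGroup G] [NormedSpace ℝ G]
    {w : ℝ → EuclideanSpace ℝ (Fin 3) → G} {I : Set ℝ}
    {S : Set (EuclideanSpace ℝ (Fin 3))} (hI : IsOpen I) (hS : IsOpen S)
    (hu : ContDiffOn ℝ ∞ (uncurry w) (I ×ˢ S)) (n : ℕ) :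
    ContinuousOn (fun q : ℝ × EuclideanSpace ℝ (Fin 3) => iteratedFDeriv ℝ n (w q.1) q.2) (I ×ˢ S) := by
  have hO : IsOpen (I ×ˢ S) := hI.prod hS
  have h1 : ContinuousOn (iteratedFDeriv ℝ n (uncurry w)) (I ×ˢ S) := by
    have h := hu.continuousOn_iteratedFDerivWithin (m := n) (by exact_mod_cast le_top) hO.uniqueDiffOn
    exact h.congr fun q hq => (iteratedFDerivWithin_of_isOpen n hO hq).symm
  have h2 : ContinuousOn (fun q : ℝ × EuclideanSpace ℝ (Fin 3) =>
      ContinuousMultilinearMap.compContinuousLinearMapL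
        (fun _ : Fin n => ContinuousLinearMap.inr ℝ ℝ (EuclideanSpace ℝ (Fin 3)))
        (iteratedFDeriv ℝ n (uncurry w) q)) (I ×ˢ S) :=
    (ContinuousMultilinearMap.compContinuousLinearMapL _).continuous.comp_continuousOn h1
  refine h2.congr fun q hq => ?_
  beta_reduce
  rw [ContinuousMultilinearMap.compContinuousLinearMapL_apply]
  exact iteratedFDeriv_slice_eq_comp_inr hO hu (x := q.1) (w := q.2) hq n

/-- The operator norm of a multilinear map into `ℝ³` is at most the sum of the norms of its
components. [folklore] -/
theorem norm_multilinear_le_sum_proj {n : ℕ}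
    (m : ContinuousMultilinearMap ℝ (fun _ : Fin n => EuclideanSpace ℝ (Fin 3)) (EuclideanSpace ℝ (Fin 3))) :
    ‖m‖ ≤ ∑ b, ‖(EuclideanSpace.proj b : EuclideanSpace ℝ (Fin 3) →L[ℝ] ℝ).compContinuousMultilinearMap m‖ := by
  refine ContinuousMultilinearMap.opNorm_le_bound (Finset.sum_nonneg fun _ _ => norm_nonneg _) fun v => ?_
  have hy : ∀ y : EuclideanSpace ℝ (Fin 3), ‖y‖ ≤ ∑ b, ‖y b‖ := by
    intro y
    have e : y = ∑ b, (y b) • (EuclideanSpace.basisFun (Fin 3) ℝ b : EuclideanSpace ℝ (Fin 3)) := by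
      simpa using ((EuclideanSpace.basisFun (Fin 3) ℝ).sum_repr y).symm
    calc ‖y‖ = ‖∑ b, (y b) • (EuclideanSpace.basisFun (Fin 3) ℝ b : EuclideanSpace ℝ (Fin 3))‖ := by rw [← e]
      _ ≤ ∑ b, ‖(y b) • (EuclideanSpace.basisFun (Fin 3) ℝ b : EuclideanSpace ℝ (Fin 3))‖ := norm_sum_le _ _
      _ = ∑ b, ‖y b‖ := Finset.sum_congr rfl fun b _ => by
          rw [norm_smul, (EuclideanSpace.basisFun (Fin 3) ℝ).orthonormal.1 b, mul_one]
  calc ‖m v‖ ≤ ∑ b, ‖m v b‖ := hy (m v)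
    _ = ∑ b, ‖((EuclideanSpace.proj b : EuclideanSpace ℝ (Fin 3) →L[ℝ] ℝ).compContinuousMultilinearMap m) v‖ :=
        Finset.sum_congr rfl fun b _ => rfl
    _ ≤ ∑ b, ‖(EuclideanSpace.proj b : EuclideanSpace ℝ (Fin 3) →L[ℝ] ℝ).compContinuousMultilinearMap m‖ *
          ∏ i, ‖v i‖ := Finset.sum_le_sum fun b _ => ContinuousMultilinearMap.le_opNorm _ _
    _ = (∑ b, ‖(EuclideanSpace.proj b : EuclideanSpace ℝ (Fin 3) →L[ℝ] ℝ).compContinuousMultilinearMap m‖) *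
          ∏ i, ‖v i‖ := by rw [Finset.sum_mul]

/-! ### The pressure-free interior bounds for classical solutions -/

set_option maxHeartbeats 1600000 in
/-- **Serrin's pressure-free interior derivative bounds for bounded classical solutions** (Serrin 1962;
Chen–Strain–Tsai–Yau 2009, Lemma A.2; Pineau–Vicol 2026, Lemma 9.1). For `k : ℕ`, `0 < r' < R` and `M`
there is `K = K(k, R, r', M) ≥ 0` such that every classical Navier–Stokes solution `(u, p)` (`ν = 1`,
`f = 0`) on `Q*_R(-R², 0) = ]-2R², 0[ × B(0, R)` with `|u| ≤ M` there satisfies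
`‖D_xᵏ u(t, ·)(x)‖ ≤ K` for all `(t, x) ∈ ]-r'², 0[ × B(0, r')`. Nothing is assumed about `p`. [folklore] -/
theorem norm_iteratedFDeriv_le_of_classical (k : ℕ) {R r' : ℝ} (hr' : 0 < r') (hr'R : r' < R) (M : ℝ) :
    ∃ K : ℝ, 0 ≤ K ∧ ∀ (u : ℝ → EuclideanSpace ℝ (Fin 3) → EuclideanSpace ℝ (Fin 3))
      (p : ℝ → EuclideanSpace ℝ (Fin 3) → ℝ),
      IsClassicalNSSolutionOnRegion
        (parabolicCylinderCentered R ((-R ^ 2 : ℝ), (0 : EuclideanSpace ℝ (Fin 3)))) 1 0 u p →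
      (∀ q ∈ parabolicCylinderCentered R ((-R ^ 2 : ℝ), (0 : EuclideanSpace ℝ (Fin 3))), ‖u q.1 q.2‖ ≤ M) →
      ∀ q ∈ Ioo (-r' ^ 2) 0 ×ˢ ball (0 : EuclideanSpace ℝ (Fin 3)) r',
        ‖iteratedFDeriv ℝ k (u q.1) q.2‖ ≤ K := by
  -- geometry
  set r₀ : ℝ := (r' + R) / 2 with hr₀
  set ρ' : ℝ := (r' + r₀) / 2 with hρ'
  have hr₀0 : 0 < r₀ := by rw [hr₀]; linarith
  have hr₀R : r₀ < R := by rw [hr₀]; linarith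
  have hr'r₀ : r' < r₀ := by rw [hr₀]; linarith
  have hρ'0 : 0 < ρ' := by rw [hρ']; linarith
  have hρ'r : ρ' < r₀ := by rw [hρ']; linarith
  have hr'ρ : r' < ρ' := by rw [hρ']; linarith
  have hL' : 0 < r' ^ 2 := by positivity
  have hL'r : r' ^ 2 < r₀ ^ 2 := by nlinarith
  obtain ⟨Ks, hKs⟩ := aeSmoothSlices hr₀0 hr₀R hL' hL'r hρ'0 hρ'r hr'ρ M
  set K : ℝ := 3 * (3 ^ k * (Ks k : ℝ)) with hK
  refine ⟨K, by positivity, fun u p hcl hbdM q hq => ?_⟩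
  set z₀ : ℝ × EuclideanSpace ℝ (Fin 3) := ((-R ^ 2 : ℝ), (0 : EuclideanSpace ℝ (Fin 3))) with hz₀
  set Qs : Set (ℝ × EuclideanSpace ℝ (Fin 3)) := parabolicCylinderCentered R z₀ with hQs
  have hQo : IsOpen Qs := isOpen_parabolicCylinderCentered R z₀
  set I : Set ℝ := Ioo (-r' ^ 2) 0 with hI
  set Bs : Set (EuclideanSpace ℝ (Fin 3)) := ball 0 r' with hBs
  have hIB : I ×ˢ Bs ⊆ Qs := by
    intro w hw
    simp only [hQs, parabolicCylinderCentered, hz₀, mem_prod, mem_Ioo, mem_ball] at hw ⊢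
    have h1 : r' ^ 2 < R ^ 2 := by nlinarith
    have h3 : dist w.2 0 < r' := hw.2
    exact ⟨⟨by nlinarith [hw.1.1], by nlinarith [hw.1.2]⟩, by linarith⟩
  -- the classical solution as a bounded distributional solution with weak gradient
  have hsol : IsDistributionalNSSolutionOn (parabolicCylinderCenteredOpens R z₀) 1 0 u p :=
    hcl.isDistributionalNSSolutionOn hQo (Q := parabolicCylinderCenteredOpens R z₀) subset_rfl
  have hG : HasWeakSpatialGradientOn (parabolicCylinderCenteredOpens R z₀) u fun t x => fderiv ℝ (u t) x :=
    hcl.hasWeakSpatialGradientOn hQo (Q := parabolicCylinderCenteredOpens R z₀) subset_rfl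
  have hbd : ∀ᵐ w ∂(volume.restrict Qs), ‖u w.1 w.2‖ ≤ M :=
    ae_restrict_of_forall_mem hQo.measurableSet fun w hw => hbdM w hw
  have hsl := hKs u p _ hsol hbd hG
  -- smoothness of `u` on `I × Bs` and of its component fields
  have hsm : ContDiffOn ℝ ∞ (uncurry u) (I ×ˢ Bs) := hcl.smooth_velocity.mono hIB
  have hsmb : ∀ b : Fin 3, ContDiffOn ℝ ∞ (uncurry fun t y => u t y b) (I ×ˢ Bs) := fun b =>
    ((EuclideanSpace.proj b : EuclideanSpace ℝ (Fin 3) →L[ℝ] ℝ).contDiff.comp_contDiffOn hsm)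
  have hslice : ∀ t ∈ I, ContDiffOn ℝ ∞ (u t) Bs := fun t ht =>
    hsm.comp (contDiffOn_const.prodMk contDiffOn_id) fun x hx => ⟨ht, hx⟩
  have hsliceb : ∀ (b : Fin 3), ∀ t ∈ I, ContDiffOn ℝ ∞ (fun y => u t y b) Bs := fun b t ht =>
    (hsmb b).comp (contDiffOn_const.prodMk contDiffOn_id) fun x hx => ⟨ht, hx⟩
  -- the components: a.e. `t`, then every `t`
  have hcomp : ∀ b : Fin 3, ∀ t ∈ I, ∀ x ∈ Bs, ‖iteratedFDeriv ℝ k (fun y => u t y b) x‖ ≤ 3 ^ k * Ks k := by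
    intro b
    have hae : ∀ᵐ t ∂(volume.restrict I), ∀ x ∈ Bs, ‖iteratedFDeriv ℝ k (fun y => u t y b) x‖ ≤ 3 ^ k * Ks k := by
      filter_upwards [hsl b, ae_restrict_mem measurableSet_Ioo] with t ht htI
      obtain ⟨v, hv, hvs, hvb, -⟩ := ht
      have hcont : ContinuousOn (fun y => u t y b) Bs := (hsliceb b t htI).continuousOn
      have heq : EqOn (fun y => u t y b) v Bs :=
        eqOn_of_ae_eq_of_continuousOn isOpen_ball hcont hvs.continuousOn hv
      intro x hx
      have hgerm : (fun y => u t y b) =ᶠ[𝓝 x] v :=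
        Filter.eventuallyEq_of_mem (isOpen_ball.mem_nhds hx) heq
      rw [(hgerm.iteratedFDeriv ℝ k).eq_of_nhds]
      exact hvb k x hx
    intro t ht x hx
    -- continuity in `t` at fixed `x`
    have hcx : ContinuousOn (fun s : ℝ => iteratedFDeriv ℝ k (fun y => u s y b) x) I := by
      have hj := continuousOn_iteratedFDeriv_slice (w := fun t y => u t y b) isOpen_Ioo isOpen_ball (hsmb b) k
      exact hj.comp (continuousOn_id.prodMk continuousOn_const) fun s hs => ⟨hs, hx⟩
    have haex : ∀ᵐ s ∂(volume.restrict I), ‖iteratedFDeriv ℝ k (fun y => u s y b) x‖ ≤ 3 ^ k * Ks k :=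
      hae.mono fun s hs => hs x hx
    exact norm_le_of_ae_of_continuousOn isOpen_Ioo hcx haex t ht
  -- the vector field
  obtain ⟨t, x⟩ := q
  have ht : t ∈ I := hq.1
  have hx : x ∈ Bs := hq.2
  have hcd : ContDiffAt ℝ k (u t) x :=
    ((hslice t ht).contDiffAt (isOpen_ball.mem_nhds hx)).of_le (by exact_mod_cast le_top)
  have hproj : ∀ b : Fin 3, (EuclideanSpace.proj b : EuclideanSpace ℝ (Fin 3) →L[ℝ] ℝ).compContinuousMultilinearMap
      (iteratedFDeriv ℝ k (u t) x) = iteratedFDeriv ℝ k (fun y => u t y b) x := by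
    intro b
    rw [← ContinuousLinearMap.iteratedFDeriv_comp_left _ hcd le_rfl]
    rfl
  calc ‖iteratedFDeriv ℝ k (u t) x‖
      ≤ ∑ b, ‖(EuclideanSpace.proj b : EuclideanSpace ℝ (Fin 3) →L[ℝ] ℝ).compContinuousMultilinearMap
          (iteratedFDeriv ℝ k (u t) x)‖ := norm_multilinear_le_sum_proj _
    _ ≤ ∑ _b : Fin 3, 3 ^ k * (Ks k : ℝ) := Finset.sum_le_sum fun b _ => by
        rw [hproj b]; exact hcomp b t ht x hx
    _ = K := by rw [Finset.sum_const, Finset.card_univ, Fintype.card_fin, nsmul_eq_mul, hK]; norm_num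

end Serrin

end Summit.NavierStokesRegularity.NavierStokesRegularity.Theorems.ScalingDefectPeepholeDoor

end
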